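import Summits.ResolutionOfSingularities.ResolutionOfSingularities.Theorems.EquisingularLiftEquisingularLiftNatNoseLiftEmpty
import Summits.ResolutionOfSingularities.ResolutionOfSingularities.Theorems.EquisingularLiftEquisingularLiftNatCITraceSmoothing
import Summits.ResolutionOfSingularities.ResolutionOfSingularities.Theorems.EquisingularLiftEquisingularLiftNatPlanarTraceSmoothing
import Summits.ResolutionOfSingularities.ResolutionOfSingularities.Theorems.EquisingularLiftEquisingularLiftGoodAtOfSmooth
import Summits.ResolutionOfSingularities.ResolutionOfSingularities.Theorems.EquisingularLiftEquisingularLiftProjectiveAmbientSmoothProper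
import HarnessLib

/-!
# [OURS · L1 W4.5(b) · EL♮(3) · WIDTH TABLE D15 «ν-LIFT DOOR»] ν3ᶜⁱ AND ν3ᵈ ARE ν-LIFT INSTANCES WITH `S = ∅` (desk R77a (ii) / R78 (iv), in kernel form):
# `LiftNose.noseLift₀_empty_of_ci` / `LiftNose.noseLift₀_empty_of_planar` — the D11 / D9 doors' equation letters inhabit `NoseLift₀ k 3 H ι Z hZ ∅ _`

res-L1-w45b-nose-w1 g7 (WIDTH seat D-0157 DOOR 1).  The desk booked «D9/D11 repackaging-drops LATER by the two S-lemmas (ν3ᵈ / ν3ᶜⁱ are instances of the ν-lift door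
with `S = ∅`), never in the D15 REPLACE itself» (R78 (iv)).  These are the two S-lemmas, as COROLLARIES of ✓-pending `LiftNose.noseLift₀_empty_of_models`
(…NatNoseLiftEmpty: a regular `O`-flat model of the nose over every admissible `(O, θ, φ)` inhabits the slot at `S = ∅`) fed with res-L1-w45b-stub-2's smoothings
✓ `Equinodal.ci_trace_smoothing` (D11, complete-intersection trace) and ✓ `Equinodal.planar_trace_smoothing` (D9, reduced planar trace); the three ambient facts the
smoothings ask for (`ℙ³_O` locally Noetherian, regular, proper over `O`) come from ✓ `stub_projectiveAmbientSmoothProper` / ✓ `stub_goodAtOfSmooth` exactly as the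
K5 engines derive them.  The DOOR-level inclusions «`ReachDirectCINoseSigmaPG₂ → ReachLiftNoseSigmaPG₂`» (blow-up of `𝓘⟨∅⟩ = ⊤` := `𝟙`, the strict transform
`closure (𝟙 ⁻¹' (Z ∖ ∅)) = Z` transported through the tail letters) are the later REPLACE's own text and are NOT here.
OURS; NOT a statement of any manuscript ([Hironaka2017] is a candidate under adjudication, nothing of it is asserted); AI-written, weaker than expert review.
DEF-FREE; no `sorry`; standard axioms.  `--kind proof --supports stmt-ResolutionOfSingularities-20148 --as helper`, counted 0.  EL♮(3) is NOT proved here.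
[folklore; pure composition of ✓ modules]
-/

set_option linter.dupNamespace false -- mandated namespace `Summit.<Summit>.<Problem>` of this single-conjunct summit

noncomputable section

open CategoryTheory CategoryTheory.Limits AlgebraicGeometry TopologicalSpace Topology IsLocalRing
open MvPolynomial
open Literature.AlgebraicGeometry.Resolution
open AlgebraicGeometry.Scheme.IdealSheafData
open Summit.ResolutionOfSingularities.ResolutionOfSingularities.Cruxes.EquisingularLift.StrataSplit

namespace Summit.ResolutionOfSingularities.ResolutionOfSingularities.Cruxes.EquisingularLiftNat.Sections.LiftNose

/-- ★ **ν3ᶜⁱ IS A ν-LIFT INSTANCE WITH `S = ∅`**: the D11 door's complete-intersection equation letters for the nose `Z ⊆ range ι` (`range ι ⊄ Z`; (N1); `Z = V₊(f₁) ∩ V₊(f₂)`,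
`f₁, f₂` homogeneous, relatively prime, `f₂ ≠ 0`, `(f₁, f₂)` radical, (HOST-J)) give `NoseLift₀ k 3 H ι Z hZ ∅ _` — via res-L1-w45b-stub-2's ✓ `Equinodal.ci_trace_smoothing`
over every admissible `(O, θ, φ)` and `noseLift₀_empty_of_models`. [OURS · L1 W4.5b · D15 instance; counted 0; EL♮(3) NOT proved] -/
theorem noseLift₀_empty_of_ci (k : Type) [Field k] [IsAlgClosed k] (H : AlgebraicGeometry.Scheme.{0})
    (ι : H ⟶ (Literature.AlgebraicGeometry.Motives.projectiveSpace 3 k).left) :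
    letI := MvPolynomial.gradedAlgebra (σ := Fin (3 + 1)) (R := k);
    -- the door's closed `Z` with FINITE non-regular locus of `Z̃ = redSub Z` ((N1), as in the planar supply)
    ∀ (Z : Set (Literature.AlgebraicGeometry.Motives.projectiveSpace 3 k).left) (hZ : IsClosed Z),
      Set.Finite {z : ↥(redSub (Literature.AlgebraicGeometry.Motives.projectiveSpace 3 k).left Z hZ) |
        ¬ IsRegularLocalRing ((redSub (Literature.AlgebraicGeometry.Motives.projectiveSpace 3 k).left Z hZ).presheaf.stalk z)} →
    -- the ci equation block DOWNSTAIRS, read exactly as ✓ `CIModel.ci_trace_and_flat`'s hypotheses: `Z = V₊(f₁) ∩ V₊(f₂)`, `f₁, f₂` homogeneous of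
    -- degrees `d₁, d₂`, relatively prime, `f₂ ≠ 0`, `(f₁, f₂)` radical
    ∀ (d₁ d₂ : ℕ) (f₁ f₂ : MvPolynomial (Fin (3 + 1)) k),
      f₁.IsHomogeneous d₁ → f₂.IsHomogeneous d₂ → IsRelPrime f₁ f₂ → f₂ ≠ 0 → (Ideal.span {f₁, f₂}).IsRadical →
      Z = {y : (Literature.AlgebraicGeometry.Motives.projectiveSpace 3 k).left | f₁ ∈ (y : ProjectiveSpectrum (MvPolynomial.homogeneousSubmodule (Fin (3 + 1)) k)).asHomogeneousIdeal ∧ f₂ ∈ (y : ProjectiveSpectrum (MvPolynomial.homogeneousSubmodule (Fin (3 + 1)) k)).asHomogeneousIdeal} →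
      -- (HOST-J): `V₊(f₁)` is smooth along `Z` — some partial derivative of `f₁` is non-zero at every point of `Z`
      (∀ y : (Literature.AlgebraicGeometry.Motives.projectiveSpace 3 k).left, y ∈ Z →
        ∃ i : Fin (3 + 1), MvPolynomial.pderiv i f₁ ∉ (y : ProjectiveSpectrum (MvPolynomial.homogeneousSubmodule (Fin (3 + 1)) k)).asHomogeneousIdeal) →
    ¬ (Set.range ι ⊆ Z) → ∀ (hE0 : IsClosed (∅ : Set (Literature.AlgebraicGeometry.Motives.projectiveSpace 3 k).left)), NoseLift₀ k 3 H ι Z hZ ∅ hE0 := by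
  classical
  letI := MvPolynomial.gradedAlgebra (σ := Fin (3 + 1)) (R := k)
  intro Z hZ hN1 d₁ d₂ f₁ f₂ hf₁ hf₂ hrel hf₂0 hrad hZeq hJ hTZ hE0
  exact noseLift₀_empty_of_models k 3 H ι Z hZ hTZ hE0 fun O _ _ _ _ _ θ hθ φ hφ' hφ => by
    letI := MvPolynomial.gradedAlgebra (σ := Fin (3 + 1)) (R := O)
    -- the three ambient facts the smoothing asks for (as the K5 engines derive them)
    obtain ⟨hsm, hprop⟩ := stub_projectiveAmbientSmoothProper O 3
    haveI : AlgebraicGeometry.Smooth (AlgebraicGeometry.Proj.toSpecZero (MvPolynomial.homogeneousSubmodule (Fin (3 + 1)) O) ≫ AlgebraicGeometry.Spec.map (CommRingCat.ofHom (algebraMap O (MvPolynomial.homogeneousSubmodule (Fin (3 + 1)) O 0)))) := hsm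
    exact Equinodal.ci_trace_smoothing k O θ hθ φ hφ' hφ (LocallyOfFiniteType.isLocallyNoetherian (AlgebraicGeometry.Proj.toSpecZero (MvPolynomial.homogeneousSubmodule (Fin (3 + 1)) O) ≫ AlgebraicGeometry.Spec.map (CommRingCat.ofHom (algebraMap O (MvPolynomial.homogeneousSubmodule (Fin (3 + 1)) O 0)))))
      (fun y => (stub_goodAtOfSmooth O _ (AlgebraicGeometry.Proj.toSpecZero (MvPolynomial.homogeneousSubmodule (Fin (3 + 1)) O) ≫ AlgebraicGeometry.Spec.map (CommRingCat.ofHom (algebraMap O (MvPolynomial.homogeneousSubmodule (Fin (3 + 1)) O 0)))) hsm y).1) hprop Z hZ hN1 d₁ d₂ f₁ f₂ hf₁ hf₂ hrel hf₂0 hrad hZeq hJ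

/-- ★ **ν3ᵈ IS A ν-LIFT INSTANCE WITH `S = ∅`**: the D9 door's reduced-planar-trace letters for the nose `Z = V₊(ℓ) ∩ V₊(g) ⊆ range ι` (`range ι ⊄ Z`; host `V₊(ℓ)`
regular along `Z̃`; (N1); `g|_Π` squarefree with hyperplane coordinates `B`, `r`) give `NoseLift₀ k 3 H ι Z hZ ∅ _` — via res-L1-w45b-stub-2's ✓
`Equinodal.planar_trace_smoothing` over every admissible `(O, θ, φ)` and `noseLift₀_empty_of_models`. [OURS · L1 W4.5b · D15 instance; counted 0; EL♮(3) NOT proved] -/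
theorem noseLift₀_empty_of_planar (k : Type) [Field k] [IsAlgClosed k] (H : AlgebraicGeometry.Scheme.{0})
    (ι : H ⟶ (Literature.AlgebraicGeometry.Motives.projectiveSpace 3 k).left) :
    letI := MvPolynomial.gradedAlgebra (σ := Fin (3 + 1)) (R := k);
    -- the door's `ℓ` and `Z`: a REDUCED PLANAR TRACE `Z = V₊(ℓ) ∩ V₊(g)`, `g|_Π` squarefree (the first block of `EqCertAt₀`, no node data)
    ∀ (ℓ : MvPolynomial (Fin (3 + 1)) k), ℓ.IsHomogeneous 1 → ℓ ≠ 0 →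
      ∀ (Z : Set (Literature.AlgebraicGeometry.Motives.projectiveSpace 3 k).left) (hZ : IsClosed Z),
        -- host regular along `Z̃` (door binder, verbatim)
        (∀ (i : redSub (Literature.AlgebraicGeometry.Motives.projectiveSpace 3 k).left Z hZ ⟶ redSub (Literature.AlgebraicGeometry.Motives.projectiveSpace 3 k).left (closure {y : (Literature.AlgebraicGeometry.Motives.projectiveSpace 3 k).left | ℓ ∈ (y : ProjectiveSpectrum (MvPolynomial.homogeneousSubmodule (Fin (3 + 1)) k)).asHomogeneousIdeal}) isClosed_closure),
              i ≫ redSubι (Literature.AlgebraicGeometry.Motives.projectiveSpace 3 k).left (closure {y : (Literature.AlgebraicGeometry.Motives.projectiveSpace 3 k).left | ℓ ∈ (y : ProjectiveSpectrum (MvPolynomial.homogeneousSubmodule (Fin (3 + 1)) k)).asHomogeneousIdeal}) isClosed_closure = redSubι (Literature.AlgebraicGeometry.Motives.projectiveSpace 3 k).left Z hZ →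
              ∀ z : ↥(redSub (Literature.AlgebraicGeometry.Motives.projectiveSpace 3 k).left Z hZ), IsRegularLocalRing ((redSub (Literature.AlgebraicGeometry.Motives.projectiveSpace 3 k).left (closure {y : (Literature.AlgebraicGeometry.Motives.projectiveSpace 3 k).left | ℓ ∈ (y : ProjectiveSpectrum (MvPolynomial.homogeneousSubmodule (Fin (3 + 1)) k)).asHomogeneousIdeal}) isClosed_closure).presheaf.stalk (i.base z))) →
        -- the non-regular locus of `Z̃` is finite ((N1); automatic for a reduced curve, taken as a binder)
        Set.Finite {z : ↥(redSub (Literature.AlgebraicGeometry.Motives.projectiveSpace 3 k).left Z hZ) |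
          ¬ IsRegularLocalRing ((redSub (Literature.AlgebraicGeometry.Motives.projectiveSpace 3 k).left Z hZ).presheaf.stalk z)} →
        ∀ (e : ℕ) (g : MvPolynomial (Fin (3 + 1)) k) (B : Fin (3 + 1) → Fin 3 → k) (r : Fin 3 → Fin (3 + 1)),
          g.IsHomogeneous e → Squarefree (restrictToHyperplane B g) →
          Z = {y : (Literature.AlgebraicGeometry.Motives.projectiveSpace 3 k).left | ℓ ∈ (y : ProjectiveSpectrum (MvPolynomial.homogeneousSubmodule (Fin (3 + 1)) k)).asHomogeneousIdeal ∧ g ∈ (y : ProjectiveSpectrum (MvPolynomial.homogeneousSubmodule (Fin (3 + 1)) k)).asHomogeneousIdeal} →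
          restrictToHyperplane B ℓ = 0 → Function.Injective r → (Matrix.of fun j j' : Fin 3 => B (r j) j').det ≠ 0 →
    ¬ (Set.range ι ⊆ Z) → ∀ (hE0 : IsClosed (∅ : Set (Literature.AlgebraicGeometry.Motives.projectiveSpace 3 k).left)), NoseLift₀ k 3 H ι Z hZ ∅ hE0 := by
  classical
  letI := MvPolynomial.gradedAlgebra (σ := Fin (3 + 1)) (R := k)
  intro ℓ hℓ1 hℓ0 Z hZ hEreg hfin e g B r hg hsq hZeq hℓB hr hdet hTZ hE0
  exact noseLift₀_empty_of_models k 3 H ι Z hZ hTZ hE0 fun O _ _ _ _ _ θ hθ φ hφ' hφ => by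
    letI := MvPolynomial.gradedAlgebra (σ := Fin (3 + 1)) (R := O)
    -- the three ambient facts the smoothing asks for (as the K5 engines derive them)
    obtain ⟨hsm, hprop⟩ := stub_projectiveAmbientSmoothProper O 3
    haveI : AlgebraicGeometry.Smooth (AlgebraicGeometry.Proj.toSpecZero (MvPolynomial.homogeneousSubmodule (Fin (3 + 1)) O) ≫ AlgebraicGeometry.Spec.map (CommRingCat.ofHom (algebraMap O (MvPolynomial.homogeneousSubmodule (Fin (3 + 1)) O 0)))) := hsm
    exact Equinodal.planar_trace_smoothing k O θ hθ φ hφ' hφ (LocallyOfFiniteType.isLocallyNoetherian (AlgebraicGeometry.Proj.toSpecZero (MvPolynomial.homogeneousSubmodule (Fin (3 + 1)) O) ≫ AlgebraicGeometry.Spec.map (CommRingCat.ofHom (algebraMap O (MvPolynomial.homogeneousSubmodule (Fin (3 + 1)) O 0)))))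
      (fun y => (stub_goodAtOfSmooth O _ (AlgebraicGeometry.Proj.toSpecZero (MvPolynomial.homogeneousSubmodule (Fin (3 + 1)) O) ≫ AlgebraicGeometry.Spec.map (CommRingCat.ofHom (algebraMap O (MvPolynomial.homogeneousSubmodule (Fin (3 + 1)) O 0)))) hsm y).1) hprop ℓ hℓ1 hℓ0 Z hZ hEreg hfin e g B r hg hsq hZeq hℓB hr hdet

end Summit.ResolutionOfSingularities.ResolutionOfSingularities.Cruxes.EquisingularLiftNat.Sections.LiftNose

end
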